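import Summits.QuantumFields.YangMills.Theorems.VirialFluxGapTauberMeanUpperPrep
import Summits.QuantumFields.YangMills.Theorems.VirialFluxGapLaplaceLayerCake
import HarnessLib

/-!
# Route `VirialFluxGap` (YangMills): the TAUBERIAN MEAN BOUND — stub `stub_tauberMeanUpper` of LINE «tauber-mean» (crux 24141) BY NAME

`TauberMeanUpper` (planner ym-idea-4 g14, HOME bc/g14-A/PeriodicSoftness_tauber_birth.lean, the Prop restated verbatim below as the type of
`tauberMeanUpper`): a two-sided small-ball law `m(t) = μ{F ≤ t} = v t^ρ ℓ(t)(1 ± κt^θ)` on `(0,t₀]` with a DECREASING log-linear slowly varying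
factor `ℓ(t) = e log(1/t) + c ≥ ℓ₀ > 0` bounds the Gibbs mean from above:
`β⟨F⟩_β = β∫F e^{−βF}/∫e^{−βF} ≤ ρ + (4ρ+5)κ((ρ+2)/β)^θ + 2/β` under the thresholds `β ≥ 2`, `κ((ρ+2)/β)^θ ≤ 1/4`,
`64(ρ+2)²(1 + |log v| + |log ℓ₀| + |log t₀| + log β) ≤ βt₀`.

Proof (the «tauber-mean» card): by the Laplace layer cake (✓`LaplaceLayerCake`) the claim is `∫_{s>0} φ(s) m(s) ds ≤ 0` with
`φ(s) = βe^{−βs}(βs − A)`, `A = 1 + ρ + E`; on `(0,t₀]` the envelope gives `φ m ≤ v(βs−A)ℓ g + vκ(βs+A)s^θ ℓ g` (`g = βe^{−βs}s^ρ`), beyond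
`t₀` simply `φ m ≤ β²s e^{−βs}`; CHEBYSHEV's association inequality for the probability density `∝ g` with the decreasing factor `ℓ·𝟙_{≤t₀}`
(✓`TauberWeights.chebyshev_weighted`) and the Gamma moments (✓`integral_linear_mul_weight`, ✓`integral_theta_mul_weight_le`) give
`∫φm ≤ v·H·(−E + κu(ρ+2+A)) + (βt₀+1)e^{−βt₀} ≤ −(3/(2β))·v·H + (βt₀+1)e^{−βt₀}` with `H = ∫_{(0,t₀]} g ℓ ≥ ℓ₀ e^{−2} β^{−ρ}`
(✓`weight_floor`), and the threshold arithmetic ✓`TauberMeanUpperPrep.tail_le_floor` closes it.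

HONEST FRAMING: an M (honestly L) pure-analysis stub of an evidence skeleton of a DRAFT-by-design second line (idle-hand material per director-ym desk
word #2 after the critic's typeread); the heart `PeriodicVolumeLaw`, the crux 24141 and the leaf are OPEN; no rung / summit statement is proved; the
Yang–Mills mass gap is NOT proved.  THEOREMS ONLY (0 `def`, 0 `sorry`), standard axioms.  References: [cite: Griffiths1964]; [cite: TomboulisYaffe1985].
-/

set_option autoImplicit false

noncomputable section

open MeasureTheory Set Filter Real
open scoped Topology
open Summit.QuantumFields.YangMills.Theorems.VirialFluxGap.ChebyshevGamma
open Summit.QuantumFields.YangMills.Theorems.VirialFluxGap.TauberWeights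
open Summit.QuantumFields.YangMills.Theorems.VirialFluxGap.TauberMeanUpperPrep
open Summit.QuantumFields.YangMills.Theorems.VirialFluxGap.LaplaceLayerCake

namespace Summit.QuantumFields.YangMills.Theorems.VirialFluxGap.TauberMeanUpper

/-! ## The stub (domination lemmas and bracket arithmetic: ✓`TauberMeanUpperPrep` §5) -/

/-- ★★★ **`TauberMeanUpper`** (the Prop of stub `stub_tauberMeanUpper` of LINE «tauber-mean» on the deciding crux stmt-QuantumFields-24141, verbatim):
a two-sided small-ball law with a decreasing log-linear slowly varying factor bounds the Gibbs mean `β⟨F⟩_β` from above by the exponent `ρ` plus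
explicit errors.  No crux / rung / summit is proved; the YM mass gap is NOT proved. [cite: Griffiths1964] [cite: TomboulisYaffe1985] -/
theorem tauberMeanUpper :
    ∀ (Ω : Type) [MeasurableSpace Ω] (μ : Measure Ω) [IsProbabilityMeasure μ] (F : Ω → ℝ) (ρ v e c κ θ t₀ ℓ₀ : ℝ),
    Measurable F → (∀ ω, 0 ≤ F ω) → 1 ≤ ρ → 0 < v → 0 ≤ e → 0 ≤ κ → 0 < θ → θ ≤ 1 → 0 < t₀ → 0 < ℓ₀ →
    (∀ t : ℝ, 0 < t → t ≤ t₀ →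
      ℓ₀ ≤ e * Real.log t⁻¹ + c ∧ |μ.real {ω | F ω ≤ t} / (v * t ^ ρ * (e * Real.log t⁻¹ + c)) - 1| ≤ κ * t ^ θ) →
    ∀ β : ℝ, 2 ≤ β → κ * ((ρ + 2) / β) ^ θ ≤ 1 / 4 →
      64 * (ρ + 2) ^ 2 * (1 + |Real.log v| + |Real.log ℓ₀| + |Real.log t₀| + Real.log β) ≤ β * t₀ →
      β * (∫ ω, F ω * Real.exp (-(β * F ω)) ∂μ) / (∫ ω, Real.exp (-(β * F ω)) ∂μ) ≤
        ρ + (4 * ρ + 5) * κ * ((ρ + 2) / β) ^ θ + 2 / β := by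
  intro Ω _ μ _ F ρ v e c κ θ t₀ ℓ₀ hF hF0 hρ hv he hκ hθ0 hθ1 ht₀ hℓ₀ H β hβ2 hκu hX
  -- constants
  have hβ0 : 0 < β := by linarith
  have hρ0 : 0 < ρ := by linarith
  have hρ1 : 0 < ρ + 1 := by linarith
  have hρm1 : -1 < ρ := by linarith
  set u : ℝ := ((ρ + 2) / β) ^ θ with hu
  have hu0 : 0 ≤ u := Real.rpow_nonneg (by positivity) _
  set E : ℝ := (4 * ρ + 5) * κ * u + 2 / β with hE
  have hE0 : 0 ≤ E := by positivity
  set A : ℝ := 1 + ρ + E with hA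
  have hA0 : 0 ≤ A := by positivity
  set C₁ : ℝ := e * |Real.log t₀| + |c| with hC₁
  have hC₁0 : 0 ≤ C₁ := by positivity
  -- thresholds
  obtain ⟨htail, h2β⟩ := tail_le_floor hρ hv hℓ₀ ht₀ hβ2 hX
  -- the functions
  set m : ℝ → ℝ := fun s => μ.real {ω | F ω ≤ s} with hm
  set ℓ : ℝ → ℝ := fun s => e * Real.log s⁻¹ + c with hℓ
  set hc : ℝ → ℝ := (Iic t₀).indicator ℓ with hhc
  set g : ℝ → ℝ := fun s => β * Real.exp (-(β * s)) * s ^ ρ with hg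
  -- `m`: monotone, measurable, `0 ≤ m ≤ 1`
  have hm_mono : Monotone m := by
    intro s s' hss'
    exact measureReal_mono (fun ω (hω : F ω ≤ s) => hω.trans hss')
  have hm_meas : Measurable m := hm_mono.measurable
  have hm0 : ∀ s, 0 ≤ m s := fun s => measureReal_nonneg
  have hm1 : ∀ s, m s ≤ 1 := fun s =>
    (measureReal_mono (subset_univ _)).trans (le_of_eq probReal_univ)
  -- the envelope on `(0, t₀]`
  have henv : ∀ s, 0 < s → s ≤ t₀ → ℓ₀ ≤ ℓ s ∧ |m s - v * s ^ ρ * ℓ s| ≤ v * s ^ ρ * ℓ s * (κ * s ^ θ) := by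
    intro s hs hst
    obtain ⟨h1, h2⟩ := H s hs hst
    have hP : 0 < v * s ^ ρ * ℓ s := by
      have := Real.rpow_pos_of_pos hs ρ
      have : 0 < ℓ s := lt_of_lt_of_le hℓ₀ h1
      positivity
    refine ⟨h1, ?_⟩
    have h3 : |m s / (v * s ^ ρ * ℓ s) - 1| = |m s - v * s ^ ρ * ℓ s| / (v * s ^ ρ * ℓ s) := by
      rw [div_sub_one hP.ne', abs_div, abs_of_pos hP]
    rw [h3, div_le_iff₀ hP] at h2
    linarith
  -- `|hc s| ≤ e s⁻¹ + C₁` and `hc s ≥ 0` on `(0,∞)`; `hc` antitone on `(0,∞)`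
  have hhc_abs : ∀ s, 0 < s → |hc s| ≤ e * s⁻¹ + C₁ := by
    intro s hs
    by_cases hst : s ≤ t₀
    · rw [hhc, indicator_of_mem (mem_Iic.mpr hst)]
      exact abs_ell_le he hs hst
    · rw [hhc, indicator_of_notMem (fun h => hst (mem_Iic.mp h)), abs_zero]
      positivity
  have hhc_nonneg : ∀ s, 0 < s → 0 ≤ hc s := by
    intro s hs
    by_cases hst : s ≤ t₀
    · rw [hhc, indicator_of_mem (mem_Iic.mpr hst)]
      exact hℓ₀.le.trans (henv s hs hst).1
    · rw [hhc, indicator_of_notMem (fun h => hst (mem_Iic.mp h))]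
  have hhc_anti : AntitoneOn hc (Ioi 0) := by
    intro x hx y hy hxy
    have hx0 : (0 : ℝ) < x := hx
    by_cases hyt : y ≤ t₀
    · have hxt : x ≤ t₀ := hxy.trans hyt
      rw [hhc, indicator_of_mem (mem_Iic.mpr hxt), indicator_of_mem (mem_Iic.mpr hyt)]
      exact ell_antitoneOn he hx hy hxy
    · rw [hhc, indicator_of_notMem (fun h => hyt (mem_Iic.mp h))]
      exact hhc_nonneg x hx0
  -- measurability
  have hℓm : Measurable ℓ := (measurable_const.mul (Real.measurable_log.comp measurable_inv)).add_const c
  have hhcm : Measurable hc := hℓm.indicator measurableSet_Iic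
  have hgm : Measurable g := (measurable_const.mul (measurable_const.mul measurable_id).neg.exp).mul (measurable_id.pow_const ρ)
  have hf₂m : Measurable (fun s : ℝ => (β * s + A) * s ^ θ) :=
    ((measurable_const.mul measurable_id).add_const A).mul (measurable_id.pow_const θ)
  -- integrability by domination (all on `(0,∞)`)
  have hgi : IntegrableOn g (Ioi 0) := integrableOn_weight hβ0 hρm1
  have hK := fun (ψ : ℝ → ℝ) (C : ℝ) (hψ : Measurable ψ)
      (hle : ∀ s ∈ Ioi (0:ℝ), |ψ s| ≤ C * (β * Real.exp (-(β * s)) * s ^ (ρ - 1) * (1 + s) ^ 3)) =>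
    integrableOn_of_le_K hβ0 hρ0 hψ hle
  have i_gh : IntegrableOn (fun s => g s * hc s) (Ioi 0) := by
    refine hK _ (1 * (e + C₁)) (hgm.mul hhcm) fun s hs => ?_
    have hs1 : (1 : ℝ) ≤ 1 + s := by have : (0:ℝ) < s := hs; linarith
    have h := dom_core (ρ := ρ) (q := 1) hβ0 hs he hC₁0 zero_le_one
      (by rw [abs_one, one_mul]; exact one_le_pow₀ hs1) (hhc_abs s hs)
    simpa [hg, one_mul] using h
  have i_gf₁h : IntegrableOn (fun s => g s * ((β * s - A) * hc s)) (Ioi 0) := by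
    refine hK _ ((β + A) * (e + C₁)) (hgm.mul (((measurable_const.mul measurable_id).sub_const A).mul hhcm)) fun s hs => ?_
    exact dom_core hβ0 hs he hC₁0 (by positivity) (linear_abs_le hβ0 hA0 hs hθ0.le hθ1).1 (hhc_abs s hs)
  have i_gf₂h : IntegrableOn (fun s => g s * (((β * s + A) * s ^ θ) * hc s)) (Ioi 0) := by
    refine hK _ ((β + A) * (e + C₁)) (hgm.mul (hf₂m.mul hhcm)) fun s hs => ?_
    exact dom_core hβ0 hs he hC₁0 (by positivity) (linear_abs_le hβ0 hA0 hs hθ0.le hθ1).2 (hhc_abs s hs)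
  have i_gf₁ : IntegrableOn (fun s => g s * (β * s - A)) (Ioi 0) := by
    refine hK _ (β + A) (hgm.mul ((measurable_const.mul measurable_id).sub_const A)) fun s hs => ?_
    exact dom_core' hβ0 hs (linear_abs_le hβ0 hA0 hs hθ0.le hθ1).1
  have i_gf₂ : IntegrableOn (fun s => g s * ((β * s + A) * s ^ θ)) (Ioi 0) := by
    refine hK _ (β + A) (hgm.mul hf₂m) fun s hs => ?_
    exact dom_core' hβ0 hs (linear_abs_le hβ0 hA0 hs hθ0.le hθ1).2
  -- the two exponential weights without `s^ρ`: `βe^{−βs}` and `βe^{−βs} s`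
  have i_w0 : IntegrableOn (fun s : ℝ => β * Real.exp (-(β * s))) (Ioi 0) :=
    (integrableOn_weight hβ0 (a := 0) (by norm_num)).congr_fun (fun s _ => by simp only [Real.rpow_zero, mul_one]) measurableSet_Ioi
  have i_w1 : IntegrableOn (fun s : ℝ => β * Real.exp (-(β * s)) * s) (Ioi 0) :=
    (integrableOn_weight hβ0 (a := 1) (by norm_num)).congr_fun (fun s _ => by simp only [Real.rpow_one]) measurableSet_Ioi
  -- `D > 0` and the reduction to `βN ≤ (ρ+E)D`
  have hDi : Integrable (fun ω => Real.exp (-(β * F ω))) μ := by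
    refine Integrable.of_bound (hF.const_mul β).neg.exp.aestronglyMeasurable 1 (ae_of_all _ fun ω => ?_)
    rw [Real.norm_eq_abs, Real.abs_exp]
    exact Real.exp_le_one_iff.mpr (by have := hF0 ω; nlinarith)
  have hD : 0 < ∫ ω, Real.exp (-(β * F ω)) ∂μ := integral_exp_pos hDi
  rw [div_le_iff₀ hD, show ρ + (4 * ρ + 5) * κ * u + 2 / β = ρ + E by rw [hE]; ring]
  -- layer cake
  rw [integral_mul_exp_neg_mul_eq_integral_cdf μ hF hF0 hβ0, integral_exp_neg_mul_eq_integral_cdf μ hF hF0 hβ0]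
  -- integrability of the two layer-cake integrands
  have i_Dm : IntegrableOn (fun s : ℝ => β * Real.exp (-(β * s)) * m s) (Ioi 0) := by
    refine Integrable.mono' i_w0 ((measurable_const.mul (measurable_const.mul measurable_id).neg.exp).mul hm_meas).aestronglyMeasurable
      (ae_of_all _ fun s => ?_)
    rw [Real.norm_eq_abs, abs_mul, abs_of_nonneg (by positivity : (0:ℝ) ≤ β * Real.exp (-(β * s))), abs_of_nonneg (hm0 s)]
    exact mul_le_of_le_one_right (by positivity) (hm1 s)
  have i_Nm : IntegrableOn (fun s : ℝ => (β * s - 1) * Real.exp (-(β * s)) * m s) (Ioi 0) := by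
    have hb : IntegrableOn (fun s : ℝ => β * Real.exp (-(β * s)) * s + β⁻¹ * (β * Real.exp (-(β * s)))) (Ioi 0) :=
      i_w1.add (i_w0.const_mul _)
    refine Integrable.mono' hb ((((measurable_const.mul measurable_id).sub_const 1).mul
      (measurable_const.mul measurable_id).neg.exp).mul hm_meas).aestronglyMeasurable ?_
    filter_upwards [ae_restrict_mem measurableSet_Ioi] with s hs
    have hs' : (0:ℝ) < s := hs
    rw [Real.norm_eq_abs, abs_mul, abs_of_nonneg (hm0 s)]
    have hexp : 0 < Real.exp (-(β * s)) := Real.exp_pos _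
    have h1 : |β * s - 1| ≤ β * s + 1 := by
      calc |β * s - 1| ≤ |β * s| + |1| := abs_sub _ _
        _ = β * s + 1 := by rw [abs_of_nonneg (by positivity), abs_one]
    calc |(β * s - 1) * Real.exp (-(β * s))| * m s ≤ |(β * s - 1) * Real.exp (-(β * s))| * 1 :=
          mul_le_mul_of_nonneg_left (hm1 s) (abs_nonneg _)
      _ = |β * s - 1| * Real.exp (-(β * s)) := by rw [mul_one, abs_mul, abs_of_pos hexp]
      _ ≤ (β * s + 1) * Real.exp (-(β * s)) := mul_le_mul_of_nonneg_right h1 hexp.le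
      _ = β * Real.exp (-(β * s)) * s + β⁻¹ * (β * Real.exp (-(β * s))) := by field_simp
  -- `βN − (ρ+E)D = ∫ φ m`
  have hφ : β * (∫ s in Ioi (0:ℝ), (β * s - 1) * Real.exp (-(β * s)) * m s) -
      (ρ + E) * (∫ s in Ioi (0:ℝ), β * Real.exp (-(β * s)) * m s) =
      ∫ s in Ioi (0:ℝ), β * Real.exp (-(β * s)) * (β * s - A) * m s := by
    rw [← integral_const_mul, ← integral_const_mul, ← integral_sub (i_Nm.const_mul β) (i_Dm.const_mul _)]
    refine setIntegral_congr_fun measurableSet_Ioi (fun s _ => ?_)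
    rw [hA]; ring
  suffices key : ∫ s in Ioi (0:ℝ), β * Real.exp (-(β * s)) * (β * s - A) * m s ≤ 0 by linarith
  -- ### the key estimate
  -- the majorant
  set M : ℝ → ℝ := fun s => v * (g s * ((β * s - A) * hc s)) + v * κ * (g s * (((β * s + A) * s ^ θ) * hc s)) +
    (Ioi t₀).indicator (fun s => β * (β * s) * Real.exp (-(β * s))) s with hM
  have i_tail : IntegrableOn (fun s : ℝ => β * (β * s) * Real.exp (-(β * s))) (Ioi 0) := by
    have h : IntegrableOn (fun s : ℝ => β * (β * Real.exp (-(β * s)) * s)) (Ioi 0) := i_w1.const_mul β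
    exact h.congr_fun (fun s _ => by ring) measurableSet_Ioi
  have i_M : IntegrableOn M (Ioi 0) :=
    ((i_gf₁h.const_mul v).add (i_gf₂h.const_mul (v * κ))).add (i_tail.indicator measurableSet_Ioi)
  have i_φm : IntegrableOn (fun s : ℝ => β * Real.exp (-(β * s)) * (β * s - A) * m s) (Ioi 0) := by
    have h : IntegrableOn (fun s : ℝ => β * ((β * s - 1) * Real.exp (-(β * s)) * m s) -
        (ρ + E) * (β * Real.exp (-(β * s)) * m s)) (Ioi 0) := (i_Nm.const_mul β).sub (i_Dm.const_mul (ρ + E))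
    exact h.congr_fun (fun s _ => by rw [hA]; ring) measurableSet_Ioi
  -- pointwise comparison
  have hpt : ∀ s ∈ Ioi (0:ℝ), β * Real.exp (-(β * s)) * (β * s - A) * m s ≤ M s := by
    intro s hs
    have hs' : (0:ℝ) < s := hs
    have hw : 0 ≤ β * Real.exp (-(β * s)) := by positivity
    by_cases hst : s ≤ t₀
    · -- inside `(0, t₀]`: envelope
      have hind : (Ioi t₀).indicator (fun s => β * (β * s) * Real.exp (-(β * s))) s = 0 :=
        indicator_of_notMem (fun h => not_lt.mpr hst (mem_Ioi.mp h)) _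
      have hcs : hc s = ℓ s := by rw [hhc, indicator_of_mem (mem_Iic.mpr hst)]
      obtain ⟨_, hdev⟩ := henv s hs' hst
      set P : ℝ := v * s ^ ρ * ℓ s with hP
      -- `φ m ≤ φ P + |φ| |m − P|`
      have h1 : β * Real.exp (-(β * s)) * (β * s - A) * m s ≤
          β * Real.exp (-(β * s)) * (β * s - A) * P + β * Real.exp (-(β * s)) * |β * s - A| * (P * (κ * s ^ θ)) := by
        have key : β * Real.exp (-(β * s)) * (β * s - A) * m s -
            (β * Real.exp (-(β * s)) * (β * s - A) * P + β * Real.exp (-(β * s)) * |β * s - A| * (P * (κ * s ^ θ))) =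
            β * Real.exp (-(β * s)) * ((β * s - A) * (m s - P) - |β * s - A| * (P * (κ * s ^ θ))) := by ring
        have h2 : (β * s - A) * (m s - P) ≤ |β * s - A| * (P * (κ * s ^ θ)) := by
          calc (β * s - A) * (m s - P) ≤ |(β * s - A) * (m s - P)| := le_abs_self _
            _ = |β * s - A| * |m s - P| := abs_mul _ _
            _ ≤ |β * s - A| * (P * (κ * s ^ θ)) := mul_le_mul_of_nonneg_left hdev (abs_nonneg _)
        have hneg : (β * s - A) * (m s - P) - |β * s - A| * (P * (κ * s ^ θ)) ≤ 0 := by linarith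
        have hprod := mul_nonpos_of_nonneg_of_nonpos hw hneg
        linarith
      have h3 : |β * s - A| ≤ β * s + A := by
        calc |β * s - A| ≤ |β * s| + |A| := abs_sub _ _
          _ = β * s + A := by rw [abs_of_nonneg (by positivity), abs_of_nonneg hA0]
      have hℓs : 0 < ℓ s := lt_of_lt_of_le hℓ₀ (henv s hs' hst).1
      have hP0 : 0 < P := by rw [hP]; exact mul_pos (mul_pos hv (Real.rpow_pos_of_pos hs' ρ)) hℓs
      have hPκ : 0 ≤ P * (κ * s ^ θ) := mul_nonneg hP0.le (mul_nonneg hκ (Real.rpow_nonneg hs'.le θ))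
      have h4 : β * Real.exp (-(β * s)) * |β * s - A| * (P * (κ * s ^ θ)) ≤
          β * Real.exp (-(β * s)) * (β * s + A) * (P * (κ * s ^ θ)) :=
        mul_le_mul_of_nonneg_right (mul_le_mul_of_nonneg_left h3 hw) hPκ
      rw [hM]; dsimp only; rw [hind, hcs, hg]; dsimp only
      have e1 : β * Real.exp (-(β * s)) * (β * s - A) * P = v * (β * Real.exp (-(β * s)) * s ^ ρ * ((β * s - A) * ℓ s)) := by
        rw [hP]; ring
      have e2 : β * Real.exp (-(β * s)) * (β * s + A) * (P * (κ * s ^ θ)) =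
          v * κ * (β * Real.exp (-(β * s)) * s ^ ρ * (((β * s + A) * s ^ θ) * ℓ s)) := by rw [hP]; ring
      linarith
    · -- beyond `t₀`: `φ m ≤ β² s e^{−βs}`
      have hst' : t₀ < s := lt_of_not_ge hst
      have hind : (Ioi t₀).indicator (fun s => β * (β * s) * Real.exp (-(β * s))) s = β * (β * s) * Real.exp (-(β * s)) :=
        indicator_of_mem (mem_Ioi.mpr hst') _
      have hcs : hc s = 0 := by rw [hhc, indicator_of_notMem (fun h => hst (mem_Iic.mp h))]
      rw [hM]; dsimp only; rw [hind, hcs]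
      simp only [mul_zero, add_zero, zero_add]
      have h1 : β * Real.exp (-(β * s)) * (β * s - A) * m s ≤ β * Real.exp (-(β * s)) * (β * s) * m s := by
        have h0 : 0 ≤ β * Real.exp (-(β * s)) * A * m s := mul_nonneg (mul_nonneg hw hA0) (hm0 s)
        have e : β * Real.exp (-(β * s)) * (β * s - A) * m s =
            β * Real.exp (-(β * s)) * (β * s) * m s - β * Real.exp (-(β * s)) * A * m s := by ring
        linarith
      have h2 : β * Real.exp (-(β * s)) * (β * s) * m s ≤ β * Real.exp (-(β * s)) * (β * s) := by
        exact mul_le_of_le_one_right (by positivity) (hm1 s)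
      linarith
  have hint_le : ∫ s in Ioi (0:ℝ), β * Real.exp (-(β * s)) * (β * s - A) * m s ≤ ∫ s in Ioi (0:ℝ), M s :=
    setIntegral_mono_on i_φm i_M measurableSet_Ioi hpt
  -- ### evaluate / bound `∫ M`
  have hM_int : ∫ s in Ioi (0:ℝ), M s = v * (∫ s in Ioi (0:ℝ), g s * ((β * s - A) * hc s)) +
      v * κ * (∫ s in Ioi (0:ℝ), g s * (((β * s + A) * s ^ θ) * hc s)) + (β * t₀ + 1) * Real.exp (-(β * t₀)) := by
    have i1v : IntegrableOn (fun s : ℝ => v * (g s * ((β * s - A) * hc s))) (Ioi 0) := i_gf₁h.const_mul v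
    have i2v : IntegrableOn (fun s : ℝ => v * κ * (g s * (((β * s + A) * s ^ θ) * hc s))) (Ioi 0) := i_gf₂h.const_mul (v * κ)
    have i12 : IntegrableOn (fun s : ℝ => v * (g s * ((β * s - A) * hc s)) + v * κ * (g s * (((β * s + A) * s ^ θ) * hc s))) (Ioi 0) :=
      i1v.add i2v
    have iind : IntegrableOn (fun s : ℝ => (Ioi t₀).indicator (fun s => β * (β * s) * Real.exp (-(β * s))) s) (Ioi 0) :=
      i_tail.indicator measurableSet_Ioi
    rw [hM]; dsimp only
    rw [integral_add i12 iind, integral_add i1v i2v, integral_const_mul, integral_const_mul,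
      setIntegral_indicator measurableSet_Ioi, Ioi_inter_Ioi, show (0:ℝ) ⊔ t₀ = t₀ from max_eq_right ht₀.le,
      integral_Ioi_sq_mul_exp hβ0 ht₀.le]
  -- Chebyshev 1: `∫ g (βs−A) hc ≤ −E ∫ g hc`
  set Hh : ℝ := ∫ s in Ioi (0:ℝ), g s * hc s with hHh
  have hG0 : 0 < ∫ s in Ioi (0:ℝ), g s := by rw [hg]; exact integral_weight_pos hβ0 hρm1
  have hg_nonneg : ∀ s ∈ Ioi (0:ℝ), 0 ≤ g s := fun s hs => by
    rw [hg]; have := Real.rpow_nonneg (le_of_lt (hs : (0:ℝ) < s)) ρ; positivity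
  have hHh0 : 0 ≤ Hh := by
    rw [hHh]; refine setIntegral_nonneg measurableSet_Ioi fun s hs => mul_nonneg (hg_nonneg s hs) (hhc_nonneg s hs)
  have hf₁mono : MonotoneOn (fun s : ℝ => β * s - A) (Ioi 0) := fun x _ y _ hxy => by
    have := mul_le_mul_of_nonneg_left hxy hβ0.le
    simp only; linarith
  have hf₂mono : MonotoneOn (fun s : ℝ => (β * s + A) * s ^ θ) (Ioi 0) := by
    intro x hx y hy hxy
    have hx0 : (0:ℝ) < x := hx
    have hy0 : (0:ℝ) < y := hy
    have h1 : β * x + A ≤ β * y + A := by have := mul_le_mul_of_nonneg_left hxy hβ0.le; linarith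
    exact mul_le_mul h1 (Real.rpow_le_rpow hx0.le hxy hθ0.le) (Real.rpow_nonneg hx0.le _)
      (by have : 0 ≤ β * y := mul_nonneg hβ0.le hy0.le; linarith)
  have cheb1 := chebyshev_weighted measurableSet_Ioi hg_nonneg hgm hgi hf₁mono hhc_anti i_gf₁ i_gh i_gf₁h
  have cheb2 := chebyshev_weighted measurableSet_Ioi hg_nonneg hgm hgi hf₂mono hhc_anti i_gf₂ i_gh i_gf₂h
  -- first moment: `∫ g (βs − A) = (ρ + 1 − A) ∫ g = −E ∫ g`
  have hmom1 : ∫ s in Ioi (0:ℝ), g s * (β * s - A) = -E * ∫ s in Ioi (0:ℝ), g s := by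
    have h := integral_linear_mul_weight hβ0 hρm1 A
    rw [hg]
    rw [show (∫ s in Ioi (0:ℝ), β * Real.exp (-(β * s)) * s ^ ρ * (β * s - A)) =
        ∫ s in Ioi (0:ℝ), (β * s - A) * (β * Real.exp (-(β * s)) * s ^ ρ) from
        setIntegral_congr_fun measurableSet_Ioi (fun s _ => by ring), h, hA]
    ring
  -- fractional moment: `∫ g (βs+A)s^θ ≤ (ρ+2+A) u ∫ g`
  have hmom2 : ∫ s in Ioi (0:ℝ), g s * ((β * s + A) * s ^ θ) ≤ (ρ + 2 + A) * u * ∫ s in Ioi (0:ℝ), g s := by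
    have h := integral_theta_mul_weight_le (A := A) hβ0 hρ1 hθ0.le hθ1 hA0
    rw [hg, hu]
    rw [show (∫ s in Ioi (0:ℝ), β * Real.exp (-(β * s)) * s ^ ρ * ((β * s + A) * s ^ θ)) =
        ∫ s in Ioi (0:ℝ), (β * s + A) * s ^ θ * (β * Real.exp (-(β * s)) * s ^ ρ) from
        setIntegral_congr_fun measurableSet_Ioi (fun s _ => by ring)]
    exact h
  have hX1 : ∫ s in Ioi (0:ℝ), g s * ((β * s - A) * hc s) ≤ -E * Hh := by
    rw [hmom1] at cheb1
    -- `X·G ≤ (−E·G)·Hh` with `G > 0`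
    have : (∫ s in Ioi (0:ℝ), g s * ((β * s - A) * hc s)) * (∫ s in Ioi (0:ℝ), g s) ≤
        (-E * Hh) * (∫ s in Ioi (0:ℝ), g s) := by rw [hHh]; linarith
    exact le_of_mul_le_mul_right this hG0
  have hX2 : ∫ s in Ioi (0:ℝ), g s * (((β * s + A) * s ^ θ) * hc s) ≤ (ρ + 2 + A) * u * Hh := by
    have h1 : (∫ s in Ioi (0:ℝ), g s * ((β * s + A) * s ^ θ)) * Hh ≤ ((ρ + 2 + A) * u * ∫ s in Ioi (0:ℝ), g s) * Hh :=
      mul_le_mul_of_nonneg_right hmom2 hHh0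
    have : (∫ s in Ioi (0:ℝ), g s * (((β * s + A) * s ^ θ) * hc s)) * (∫ s in Ioi (0:ℝ), g s) ≤
        ((ρ + 2 + A) * u * Hh) * (∫ s in Ioi (0:ℝ), g s) := by rw [hHh] at h1 ⊢; linarith
    exact le_of_mul_le_mul_right this hG0
  -- the floor `Hh ≥ ℓ₀ e^{−2} β^{−ρ}`
  have hfloor : ℓ₀ * (Real.exp (-2) * β ^ (-ρ)) ≤ Hh := by
    have hsub : Ioc (0:ℝ) t₀ ⊆ Ioi 0 := Ioc_subset_Ioi_self
    have hgi' : IntegrableOn g (Ioc 0 t₀) := hgi.mono_set hsub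
    have h1 : ℓ₀ * (Real.exp (-2) * β ^ (-ρ)) ≤ ∫ s in Ioc (0:ℝ) t₀, g s * ℓ₀ := by
      rw [integral_mul_const, mul_comm]
      exact mul_le_mul_of_nonneg_right (by rw [hg]; exact weight_floor hβ0 hρ0.le h2β) hℓ₀.le
    have h2 : ∫ s in Ioc (0:ℝ) t₀, g s * ℓ₀ ≤ ∫ s in Ioc (0:ℝ) t₀, g s * hc s := by
      refine setIntegral_mono_on (hgi'.mul_const _) (i_gh.mono_set hsub) measurableSet_Ioc fun s hs => ?_
      have hcs : hc s = ℓ s := by rw [hhc, indicator_of_mem (mem_Iic.mpr hs.2)]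
      rw [hcs]
      exact mul_le_mul_of_nonneg_left (henv s hs.1 hs.2).1 (hg_nonneg s (hsub hs))
    have h3 : ∫ s in Ioc (0:ℝ) t₀, g s * hc s ≤ Hh := by
      rw [hHh]
      refine setIntegral_mono_set i_gh ?_ (Eventually.of_forall hsub)
      filter_upwards [ae_restrict_mem measurableSet_Ioi] with s hs using mul_nonneg (hg_nonneg s hs) (hhc_nonneg s hs)
    exact h1.trans (h2.trans h3)
  -- bracket arithmetic: `−E + κu(ρ+2+A) ≤ −3/(2β)`
  have hbracket : v * (-E * Hh) + v * κ * ((ρ + 2 + A) * u * Hh) ≤ -(3 / (2 * β)) * (v * Hh) := by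
    have hvH : 0 ≤ v * Hh := mul_nonneg hv.le hHh0
    have hkey : -E + κ * u * (ρ + 2 + A) ≤ -(3 / (2 * β)) := by
      have h := bracket_le hρ0 hβ0 (mul_nonneg hκ hu0) hκu
      rw [hA, hE]
      linarith [h]
    have h := mul_le_mul_of_nonneg_left hkey hvH
    have e : v * (-E * Hh) + v * κ * ((ρ + 2 + A) * u * Hh) = v * Hh * (-E + κ * u * (ρ + 2 + A)) := by ring
    rw [e]
    calc v * Hh * (-E + κ * u * (ρ + 2 + A)) ≤ v * Hh * (-(3 / (2 * β))) := h
      _ = -(3 / (2 * β)) * (v * Hh) := by ring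
  -- the tail against the floor
  have htail' : (β * t₀ + 1) * Real.exp (-(β * t₀)) ≤ 3 / (2 * β) * (v * (ℓ₀ * (Real.exp (-2) * β ^ (-ρ)))) := by
    have hsplit : β ^ (-(ρ + 1)) = β ^ (-ρ) * β⁻¹ := by
      rw [show -(ρ + 1) = -ρ + (-1) by ring, Real.rpow_add hβ0, Real.rpow_neg_one]
    rw [hsplit] at htail
    calc (β * t₀ + 1) * Real.exp (-(β * t₀)) ≤ 3 / 2 * v * ℓ₀ * Real.exp (-2) * (β ^ (-ρ) * β⁻¹) := htail
      _ = 3 / (2 * β) * (v * (ℓ₀ * (Real.exp (-2) * β ^ (-ρ)))) := by field_simp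
  have htail'' : (β * t₀ + 1) * Real.exp (-(β * t₀)) ≤ 3 / (2 * β) * (v * Hh) := by
    refine htail'.trans (mul_le_mul_of_nonneg_left (mul_le_mul_of_nonneg_left hfloor hv.le) (by positivity))
  -- conclude
  calc ∫ s in Ioi (0:ℝ), β * Real.exp (-(β * s)) * (β * s - A) * m s ≤ ∫ s in Ioi (0:ℝ), M s := hint_le
    _ = v * (∫ s in Ioi (0:ℝ), g s * ((β * s - A) * hc s)) +
        v * κ * (∫ s in Ioi (0:ℝ), g s * (((β * s + A) * s ^ θ) * hc s)) + (β * t₀ + 1) * Real.exp (-(β * t₀)) := hM_int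
    _ ≤ v * (-E * Hh) + v * κ * ((ρ + 2 + A) * u * Hh) + (β * t₀ + 1) * Real.exp (-(β * t₀)) := by
        have h1 := mul_le_mul_of_nonneg_left hX1 hv.le
        have h2 := mul_le_mul_of_nonneg_left hX2 (mul_nonneg hv.le hκ)
        linarith
    _ ≤ -(3 / (2 * β)) * (v * Hh) + 3 / (2 * β) * (v * Hh) := add_le_add hbracket htail''
    _ = 0 := by ring

end Summit.QuantumFields.YangMills.Theorems.VirialFluxGap.TauberMeanUpper

end
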